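import Literature.NumberTheory.EllipticCurves.TakahashiRankOneOfEichlerSelberg
import Literature.NumberTheory.EllipticCurves.TakahashiDegreeFormulaCoprimeProofs
import Literature.NumberTheory.EllipticCurves.EichlerBasisTheoremOfTraceIdentity
import Literature.NumberTheory.Automorphic.EichlerSubidealCount
import HarnessLib

/-!
# Stub ideation k1 (gen 2, FAMILY 1 — recognise & import) for `stub_takahashi`
# (crux `DefiniteRTControlPrime`, stmt-ABC-11338): elaboration sketch of the helper lemmas

`stub_takahashi : takahashi2001_thm_2_3_of_coprime` is a NAMED FACT of the tree.  The three gen-1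
plans (`STUB-IDEAS-stub_takahashi-{1,2,3}.md`, `StubIdeas3Sketch.lean`) agree on the split
stub ⇐ H1 (rank one of the Brandt eigen-lattice at `M.Coprime r`) + H2 (character-group dictionary
at `r ∥ N`), H1 ⇐ H0 (Pizer 1980 (2.8) at `r = 0`, `M` arbitrary).  This file types the ONE place
where the tree's proof of H0 uses `Squarefree M` — the evaluation of the elliptic terms of
`tr B(n)` (`Brandt.XiSetup.ellipticTerm_eq`) — and shows, kernel-checked, that removing that single
hypothesis makes H0 and H1 theorems CONDITIONAL ONLY ON THE TREE'S EXISTING NAMED FACT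
`HeckeTraceFormulaGL2Level N 𝟙 2` (Eichler–Selberg, all `N`; proved in the tree at squarefree `N`).
Sorries: exactly the helper statements `helper_*` (targets for provers); everything named `glue_*`
is proved here.
-/

noncomputable section

open scoped MatrixGroups ModularForm ArithmeticFunction.sigma
open CongruenceSubgroup ArithmeticFunction

namespace Summit.ABC.ABC.Cruxes.DefiniteRTControlPrime.StubIdeas1

open Literature.NumberTheory.EllipticCurves Literature.NumberTheory.EllipticCurves.ModularForms
open Literature.NumberTheory.Automorphic Literature.NumberTheory.Automorphic.Brandt
open Literature.NumberTheory.Automorphic.HeckeTraceFormulaGL2Level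
open Literature.NumberTheory.EllipticCurves.BrandtJL

/-! ### The statements H0, H1 at coprime level (verbatim `StubIdeas3Sketch.lean`, k3) -/

/-- H1 = `StubIdeas3.brandtEigenLattice_rank_one_of_coprime` (verbatim). -/
def rankOneCoprime : Prop :=
  ∀ (W : WeierstrassCurve ℚ) [W.IsElliptic] (M r : ℕ) [NeZero (M * r)],
    r.Prime → M.Coprime r → W.conductorNorm ℤ = M * r →
    ∀ (_P : ModularParametrizationData W (M * r)) (S : Brandt.XiSetup M r)
      [Fintype (Brandt.ClassSet S.O)],
      Module.finrank ℤ
        (Brandt.eigenLattice (M * r) (Brandt.matrix S.O) (fun n => W.LFunction n)) = 1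

/-- H0 = `StubIdeas3.pizerTraceIdentity_of_coprime` (verbatim): Pizer 1980 Thm. 2.25 (2.8),
`r = 0`, `k = 2`, `M` ARBITRARY prime to `p` (held text p. 359; Remark 2.26: `r = 0` is
Hijikata–Saito 1973 Lemma 1). -/
def traceIdentityCoprime : Prop :=
  ∀ (M r : ℕ) [NeZero M] [NeZero (M * r)], r.Prime → M.Coprime r →
    ∀ (S : Brandt.XiSetup M r) [Fintype (Brandt.ClassSet S.O)], ∀ n : ℕ, 0 < n → n.Coprime (M * r) →
      cuspidalHeckeTrace (M * r) 2 1 n =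
        (((Brandt.matrix S.O n).trace : ℤ) : ℂ) - ((σ 1 n : ℕ) : ℂ) + 2 * cuspidalHeckeTrace M 2 1 n

/-! ### PLAN A helper: the elliptic terms of `tr B(n; p, M)` WITHOUT `Squarefree M` -/

/-- **helper_ellipticTerm (HA1, the one new brick; L-sized).** `Brandt.XiSetup.ellipticTerm_eq`
with its hypothesis `hsq : Squarefree M` deleted: for a Brandt setup of type `(M, p)`, `p ∤ M`,
`(n, Mp) = 1`, `t² < 4n`,
`Σ_i #{x ∈ O_L(I_i) : (trd,nrd) x = (t,n)}/(2wᵢ) = ½ Σ_f h_w((t²-4n)/f²) μ_M(t,f,n)(2 - μ_p(t,f,n))`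
with `μ_M` the Eichler–Selberg local density of the tree (`localDensity M 𝟙`, Schoof–van der Vlugt
Thm. 2.2 / Cohen / Oesterlé, defined at every `M`).  Internal route (all inside the existing
`Brandt` local machinery): (a) matrix model of level `q^{v_q(M)}` — IN TREE,
`exists_levelModel_general` (GrossPointsExistenceGeneralLevel); (b) local optimal-embedding numbers
of `B_f` into the level-`q^e` Eichler order (Hijikata 1974 §2; Brzezinski 1991), generalising
`XiSetup.localEmbeddingNumber_ordOf_level` (`e = 1`, `brFactor`); (c) evaluation of
`localDensity (q^e) 1 t f n` from its definition and `localDensity_one_mul` (IN TREE) in place of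
`localDensity_squarefree_one_eq`; (d) the resummation `Σ_f h_w ∏ μ = Σ_f h_w ∏ m` one prime at a
time (`sum_hw_es_eq_sum_hw_br`, `chainW`) with the level-`q^e` factors. -/
theorem helper_ellipticTerm {M p : ℕ} (S : XiSetup M p) [Fintype (ClassSet S.O)] [NeZero M]
    (hp : p.Prime) (hpM : ¬ p ∣ M) {n : ℕ} (hn : n.Coprime (M * p)) {t : ℤ} (ht : t ^ 2 < 4 * n) :
    ((∑ i, (Nat.card (traceNormSet i.rep (t : ℚ) (n : ℚ)) : ℚ) / (2 * weight S.O i) : ℚ) : ℂ) =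
      (1 / 2 : ℂ) * ∑ f ∈ ellipticConductors t n,
        (weightedClassNumber ((t ^ 2 - 4 * n) / (f : ℤ) ^ 2) : ℂ) *
          (localDensity M 1 t f n * (2 - localDensity p 1 t f n)) := by
  sorry

/-- **Sanity: HA1 is a theorem of the tree at squarefree `M`** (so the helper is a strict
generalisation of `Brandt.XiSetup.ellipticTerm_eq`, not a restatement of the stub). -/
theorem helper_ellipticTerm_squarefree_case {M p : ℕ} (S : XiSetup M p) [Fintype (ClassSet S.O)]
    [NeZero M] (hsq : Squarefree M) (hp : p.Prime) (hpM : ¬ p ∣ M) {n : ℕ} (hn : n.Coprime (M * p))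
    {t : ℤ} (ht : t ^ 2 < 4 * n) :
    ((∑ i, (Nat.card (traceNormSet i.rep (t : ℚ) (n : ℚ)) : ℚ) / (2 * weight S.O i) : ℚ) : ℂ) =
      (1 / 2 : ℂ) * ∑ f ∈ ellipticConductors t n,
        (weightedClassNumber ((t ^ 2 - 4 * n) / (f : ℤ) ^ 2) : ℂ) *
          (localDensity M 1 t f n * (2 - localDensity p 1 t f n)) :=
  S.ellipticTerm_eq hsq hp hpM hn ht

/-! ### PLAN A glue (proved): HA1 ⇒ Eichler's trace formula ⇒ (2.8) ⇒ H1, granting only the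
tree's named fact `HeckeTraceFormulaGL2Level N 𝟙 2` -/

/-- **glue_traceMatrix (HA2; proof = the tree's 10 lines of `trace_matrix_eq_sumInvWeight_add`
with `ellipticTerm_eq hsq` ↦ `helper_ellipticTerm`).** -/
theorem glue_traceMatrix {M p : ℕ} (S : XiSetup M p) [Fintype (ClassSet S.O)] [NeZero M]
    (hp : p.Prime) (hpM : ¬ p ∣ M) (n : ℕ) (hn0 : 0 < n) (hn : n.Coprime (M * p)) :
    (((Brandt.matrix S.O n).trace : ℤ) : ℂ) =
      (if IsSquare n then ∑ i, (1 : ℂ) / (weight S.O i : ℂ) else 0) +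
        (1 / 2 : ℂ) *
          ∑ t ∈ (Finset.Icc (-(2 * n : ℤ)) (2 * n)).filter (fun t : ℤ => t ^ 2 < 4 * (n : ℤ)),
            ∑ f ∈ ellipticConductors t n,
              (weightedClassNumber ((t ^ 2 - 4 * n) / (f : ℤ) ^ 2) : ℂ) *
                (localDensity M 1 t f n * (2 - localDensity p 1 t f n)) := by
  have hQ := S.trace_matrix_eq_mass_add_sum hn0.ne'
  have hQC := congrArg (fun x : ℚ => (x : ℂ)) hQ
  beta_reduce at hQC
  push_cast at hQC
  rw [hQC, Finset.mul_sum]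
  congr 1
  · split_ifs <;> push_cast <;> ring
  · refine Finset.sum_congr rfl fun t ht => ?_
    rw [Finset.mem_filter] at ht
    have := helper_ellipticTerm S hp hpM hn ht.2
    push_cast at this
    exact this

/-- **glue_comparison (HA3; proof = the tree's `sumInvWeight_eq_and_traceIdentity_of_cuspidalHeckeTrace_eq`
verbatim with `trace_matrix_eq_sumInvWeight_add hsq` ↦ `glue_traceMatrix`): mass formula AND (2.8)
at coprime level from the Eichler–Selberg identities at the levels `Mp`, `M` for `(n, Mp) = 1`.** -/
theorem glue_comparison {M p : ℕ} [NeZero M] [NeZero (M * p)] (hp : p.Prime) (hpM : ¬ p ∣ M)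
    (S : XiSetup M p) [Fintype (ClassSet S.O)]
    (hES₁ : ∀ n : ℕ, 0 < n → n.Coprime (M * p) → cuspidalHeckeTrace (M * p) 2 1 n = geometricSide (M * p) 1 2 n)
    (hES₂ : ∀ n : ℕ, 0 < n → n.Coprime (M * p) → cuspidalHeckeTrace M 2 1 n = geometricSide M 1 2 n) :
    (∑ i, (1 : ℂ) / (weight S.O i : ℂ)) = ((p : ℂ) - 1) * (dedekindPsi M : ℂ) / 12 ∧
      ∀ n : ℕ, 0 < n → n.Coprime (M * p) →
        cuspidalHeckeTrace (M * p) 2 1 n =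
          (((Brandt.matrix S.O n).trace : ℤ) : ℂ) - ((σ 1 n : ℕ) : ℂ) + 2 * cuspidalHeckeTrace M 2 1 n := by
  classical
  set μ : ℂ := ∑ i, (1 : ℂ) / (weight S.O i : ℂ) with hμ
  set c₀ : ℂ := ((p : ℂ) - 1) * (dedekindPsi M : ℂ) / 12 - μ with hc₀
  -- Step 1: the two trace formulas give the trace identity up to the defect `δ(n = □) c₀`
  have hdef : ∀ n : ℕ, 0 < n → n.Coprime (M * p) →
      cuspidalHeckeTrace (M * p) 2 1 n + ((σ 1 n : ℕ) : ℂ) =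
        (((Brandt.matrix S.O n).trace : ℤ) : ℂ) + 2 * cuspidalHeckeTrace M 2 1 n +
          (if IsSquare n then c₀ else 0) := by
    intro n hn0 hn
    have h : cuspidalHeckeTrace (M * p) 2 1 n - 2 * cuspidalHeckeTrace M 2 1 n =
        (if IsSquare n then ((p : ℂ) - 1) * (dedekindPsi M : ℂ) / 12 else 0) - ((σ 1 n : ℕ) : ℂ) -
          (1 / 2 : ℂ) *
            ∑ t ∈ (Finset.Icc (-(2 * n : ℤ)) (2 * n)).filter (fun t : ℤ => t ^ 2 < 4 * (n : ℤ)),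
              ∑ f ∈ ellipticConductors t n,
                (weightedClassNumber ((t ^ 2 - 4 * n) / (f : ℤ) ^ 2) : ℂ) *
                  (localDensity M 1 t f n * (localDensity p 1 t f n - 2)) := by
      rw [hES₁ n hn0 hn, hES₂ n hn0 hn]
      exact geometricSide_one_two_mul_prime_sub hp hpM hn
    have hBn := glue_traceMatrix S hp hpM n hn0 hn
    have hneg : (∑ t ∈ (Finset.Icc (-(2 * n : ℤ)) (2 * n)).filter (fun t : ℤ => t ^ 2 < 4 * (n : ℤ)),
        ∑ f ∈ ellipticConductors t n,
          (weightedClassNumber ((t ^ 2 - 4 * n) / (f : ℤ) ^ 2) : ℂ) *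
            (localDensity M 1 t f n * (2 - localDensity p 1 t f n))) =
        -∑ t ∈ (Finset.Icc (-(2 * n : ℤ)) (2 * n)).filter (fun t : ℤ => t ^ 2 < 4 * (n : ℤ)),
          ∑ f ∈ ellipticConductors t n,
            (weightedClassNumber ((t ^ 2 - 4 * n) / (f : ℤ) ^ 2) : ℂ) *
              (localDensity M 1 t f n * (localDensity p 1 t f n - 2)) := by
      rw [← Finset.sum_neg_distrib]
      refine Finset.sum_congr rfl fun t _ ↦ ?_
      rw [← Finset.sum_neg_distrib]
      refine Finset.sum_congr rfl fun f _ ↦ ?_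
      ring
    rw [hneg, ← hμ] at hBn
    rw [hc₀]
    split_ifs at h hBn ⊢ with hsqn
    · linear_combination h - hBn
    · linear_combination h - hBn
  -- Step 2: the two semisimple Hecke families `S₂(Mp) ⊕ ℂ_{σ₁}` and `ℂ^{Cls O} ⊕ S₂(M)²`
  haveI : FiniteDimensional ℂ (CuspForm (Gamma0 M) 2) := finiteDimensional_cuspForm_gamma0 M 2
  haveI : FiniteDimensional ℂ (CuspForm (Gamma0 (M * p)) 2) := finiteDimensional_cuspForm_gamma0 (M * p) 2
  have hMN : M ∣ M * p := dvd_mul_right M p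
  set σ₁ : ℕ → ℂ := fun n => ((σ 1 n : ℕ) : ℂ) with hσ₁
  set TA : ℕ → Module.End ℂ (CuspForm (Gamma0 (M * p)) 2 × ℂ) :=
    fun n => (heckeTnGamma0 (M * p) 2 n).prodMap (scalarFamily ℂ σ₁ n) with hTA
  set TB : ℕ → Module.End ℂ ((ClassSet S.O → ℂ) × (CuspForm (Gamma0 M) 2 × CuspForm (Gamma0 M) 2)) :=
    fun n => (S.heckeFamily n).prodMap ((heckeTnGamma0 M 2 n).prodMap (heckeTnGamma0 M 2 n)) with hTB
  have hM2 : IsHeckeFamily (M * p) (fun q => (q : ℂ)) (heckeTnGamma0 M 2) :=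
    isHeckeFamily_of_dvd hMN (isHeckeFamily_heckeTnGamma0_two M)
  have hA : IsHeckeFamily (M * p) (fun q => (q : ℂ)) TA :=
    (isHeckeFamily_heckeTnGamma0_two (M * p)).prod (isHeckeFamily_sigmaOne ℂ (M * p))
  have hB : IsHeckeFamily (M * p) (fun q => (q : ℂ)) TB := S.isHeckeFamily.prod (hM2.prod hM2)
  have hsM : IsSemisimpleFamily (M * p) (heckeTnGamma0 M 2) :=
    isSemisimpleFamily_of_dvd hMN (isSemisimpleFamily_heckeTnGamma0 M 2)
  have hsA : IsSemisimpleFamily (M * p) TA :=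
    (isSemisimpleFamily_heckeTnGamma0 (M * p) 2).prod (isSemisimpleFamily_scalarFamily σ₁)
  have hsB : IsSemisimpleFamily (M * p) TB := S.isSemisimpleFamily.prod (hsM.prod hsM)
  have htr : ∀ n : ℕ, 0 < n → n.Coprime (M * p) →
      LinearMap.trace ℂ _ (TA n) = LinearMap.trace ℂ _ (TB n) + if IsSquare n then c₀ else 0 := by
    intro n hn hnN
    rw [hTA, hTB]
    simp only [LinearMap.trace_prodMap', S.trace_heckeFamily, trace_heckeTnGamma0,
      trace_scalarFamily_complex]
    have := hdef n hn hnN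
    linear_combination this
  -- Step 3: a prime `q ∤ Mp`; `c(q) = q ∉ {0, 1, -1}`; the defect vanishes
  obtain ⟨q, hqge, hq⟩ := Nat.exists_infinite_primes (M * p + 1)
  have hqN : ¬ q ∣ M * p := fun h => by
    have := Nat.le_of_dvd (Nat.pos_of_ne_zero (NeZero.ne _)) h
    omega
  have hq0 : ((q : ℕ) : ℂ) ≠ 0 := by exact_mod_cast hq.ne_zero
  have hq1 : ((q : ℕ) : ℂ) ≠ 1 := by exact_mod_cast hq.one_lt.ne'
  have hq2 : ((q : ℕ) : ℂ) ≠ -1 := fun h => by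
    have := congrArg Complex.re h
    simp only [Complex.natCast_re, Complex.neg_re, Complex.one_re] at this
    have h0 : (0 : ℝ) ≤ q := Nat.cast_nonneg q
    linarith
  have hc : c₀ = 0 :=
    eq_zero_of_trace_eq_trace_add_indicator_isSquare hA hB hsA hsB ⟨q, hq, hqN⟩ hq0 hq1 hq2 htr
  -- conclusion
  refine ⟨?_, fun n hn0 hn => ?_⟩
  · rw [hc₀] at hc
    linear_combination -hc
  · have := hdef n hn0 hn
    rw [hc] at this
    simp only [ite_self, add_zero] at this
    linear_combination this

/-- **glue_H0 (HA4): (2.8) at every coprime level, granting ONLY the tree's existing named fact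
`HeckeTraceFormulaGL2Level N 𝟙 2` (all `N`).** -/
theorem glue_H0 (hTF : ∀ (N : ℕ) [NeZero N], HeckeTraceFormulaGL2Level N 1 2) :
    traceIdentityCoprime := by
  intro M r _ _ hr hcop S _ n hn0 hn
  have hrM : ¬ r ∣ M := fun h => hr.ne_one ((Nat.coprime_comm.mp hcop).eq_one_of_dvd h)
  exact (glue_comparison hr hrM S
    (fun n hn0 _ => hTF (M * r) le_rfl (dirichletCharacter_one_neg_one_eq _) n hn0)
    (fun n hn0 _ => hTF M le_rfl (dirichletCharacter_one_neg_one_eq _) n hn0)).2 n hn0 hn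

/-- **glue_H1_of_H0** (= k3's `rank_one_of_coprime_of_traceIdentity`; engine
`BrandtJL.finrank_eigenLattice_eq_one_of_traceIdentity`, no square-freeness). -/
theorem glue_H1_of_H0 (h : traceIdentityCoprime) : rankOneCoprime := by
  intro W _ M r _ hr hcop _hN P S _
  haveI : NeZero M := ⟨fun h0 => NeZero.ne (M * r) (by rw [h0, zero_mul])⟩
  exact finrank_eigenLattice_eq_one_of_traceIdentity S (h M r hr hcop S) W hr.one_lt P

/-- **PLAN A, assembled: H1 (multiplicity one at every coprime level) is a theorem conditional
only on `helper_ellipticTerm` and the tree's standing named fact `HeckeTraceFormulaGL2Level`.**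
With H2 (`StubIdeas3.characterGroupDictionary_of_coprime`) this gives the stub by
`StubIdeas3.stub_takahashi_of_split` / `takahashi2001_thm_2_3_of_coprime_of_brandtDictionary_one'`. -/
theorem glue_H1 (hTF : ∀ (N : ℕ) [NeZero N], HeckeTraceFormulaGL2Level N 1 2) : rankOneCoprime :=
  glue_H1_of_H0 (glue_H0 hTF)

/-- **Bonus of PLAN A: Eichler's mass formula at EVERY Eichler level `M` prime to `p`**
(`Σᵢ 1/wᵢ = (p-1)ψ(M)/12`), granting the same named fact — the first conjunct of `glue_comparison`. -/
theorem glue_massFormula (hTF : ∀ (N : ℕ) [NeZero N], HeckeTraceFormulaGL2Level N 1 2)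
    {M p : ℕ} [NeZero M] [NeZero (M * p)] (hp : p.Prime) (hpM : ¬ p ∣ M)
    (S : XiSetup M p) [Fintype (ClassSet S.O)] :
    (∑ i, (1 : ℂ) / (weight S.O i : ℂ)) = ((p : ℂ) - 1) * (dedekindPsi M : ℂ) / 12 :=
  (glue_comparison hp hpM S
    (fun n hn0 _ => hTF (M * p) le_rfl (dirichletCharacter_one_neg_one_eq _) n hn0)
    (fun n hn0 _ => hTF M le_rfl (dirichletCharacter_one_neg_one_eq _) n hn0)).1

/-! ### PLAN B helper: the dictionary pinned to the degree-zero lattice (Kohel Thm. 4.3 verbatim) -/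

/-- The degree-zero sublattice `ℤ[Cls O]⁰ = {v : Σ_c v_c = 0}` (the character group `X_r(J₀(rM))`
under Ribet's / Kohel's isometry). -/
def degreeZeroLattice (ι : Type*) [Fintype ι] : Submodule ℤ (ι → ℤ) :=
  LinearMap.ker (∑ i : ι, LinearMap.proj i)

theorem mem_degreeZeroLattice_iff {ι : Type*} [Fintype ι] {v : ι → ℤ} :
    v ∈ degreeZeroLattice ι ↔ ∑ i, v i = 0 := by
  simp [degreeZeroLattice, LinearMap.mem_ker]

/-- **glue_saturated (proved): `ℤ[Cls O]⁰` is saturated** — the clause `hXsat` of H2 is automatic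
once `X` is pinned. -/
theorem glue_saturated {ι : Type*} [Fintype ι] (m : ℤ) (v : ι → ℤ) (hm : m ≠ 0)
    (h : m • v ∈ degreeZeroLattice ι) : v ∈ degreeZeroLattice ι := by
  rw [mem_degreeZeroLattice_iff] at h ⊢
  have : ∑ i, (m • v) i = m * ∑ i, v i := by
    simp [Pi.smul_apply, Finset.mul_sum]
  rw [this] at h
  exact (mul_eq_zero.mp h).resolve_left hm

/-- **glue_eigen_le_degreeZero (proved, tree match): the `a(W)`-eigen-lattice lies in `ℤ[Cls O]⁰`
at EVERY level** — `XiSetup.sum_eq_zero_of_mem_eigenLattice_lFunction'` (Eichler's `p + 1`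
sub-ideal count + Hasse), no square-freeness. So the clause "`π^* 1 ∈ L ⊆ X`" of the dictionary is
consistent with `X = ℤ[Cls O]⁰` for free. -/
theorem glue_eigen_le_degreeZero {Nplus Nminus : ℕ} (S : XiSetup Nplus Nminus)
    [Fintype (ClassSet S.O)] (W : WeierstrassCurve ℚ) [W.IsElliptic] :
    eigenLattice (Nplus * Nminus) (matrix S.O) (fun n => W.LFunction n) ≤
      degreeZeroLattice (ClassSet S.O) := fun _ hv =>
  mem_degreeZeroLattice_iff.mpr (S.sum_eq_zero_of_mem_eigenLattice_lFunction' W hv)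

/-- **H2′ (named-fact candidate, sharper than H2): the dictionary with `X := ℤ[Cls O]⁰` PINNED**
(Kohel 2001 Thm. 4.3 at `D = 1`: `X_r(J₀(Mr)) ≅ ℤ[Cls O]⁰` isometrically and `T_n`-compatibly,
`(n, rM) = 1`, `M` arbitrary; Conrad–Stein 2001 §7.1 (`N = Mp`, purely toric `p`-new part),
Thm. 6.1 / Cor. 6.6 (the `π_*, π^*` bookkeeping); SGA7 IX 11.5).  One existential fewer than H2. -/
def dictCoprimePinned : Prop :=
  ∀ (W : WeierstrassCurve ℚ) [W.IsElliptic] (M r : ℕ) [NeZero (M * r)],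
    r.Prime → M.Coprime r → W.conductorNorm ℤ = M * r →
    ∀ P : ModularParametrizationData W (M * r),
      (∀ (W' : WeierstrassCurve ℚ) [W'.IsElliptic], W'.conductorNorm ℤ = M * r →
          ∀ P' : ModularParametrizationData W' (M * r),
          P'.f = P.f → P.modularDegree ≤ P'.modularDegree) →
      ∀ (S : Brandt.XiSetup M r) [Fintype (Brandt.ClassSet S.O)],
        ∃ (pb : ℤ →ₗ[ℤ] degreeZeroLattice (Brandt.ClassSet S.O))
          (pf : degreeZeroLattice (Brandt.ClassSet S.O) →ₗ[ℤ] ℤ),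
          (∀ (a : ℤ) (y : degreeZeroLattice (Brandt.ClassSet S.O)),
              ∑ i, (Brandt.weight S.O i : ℤ) * (pb a : Brandt.ClassSet S.O → ℤ) i *
                  (y : Brandt.ClassSet S.O → ℤ) i =
                ((W.minimalDiscriminantNorm ℤ).factorization r : ℤ) * a * pf y) ∧
          (∀ a : ℤ, pf (pb a) = (P.modularDegree : ℤ) * a) ∧
          Function.Surjective pf ∧
          (pb 1 : Brandt.ClassSet S.O → ℤ) ∈
            Brandt.eigenLattice (M * r) (Brandt.matrix S.O) (fun n => W.LFunction n)

/-- **glue_stub (proved): H1 + H2′ ⇒ the stub**, through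
`takahashi2001_thm_2_3_of_coprime_of_brandtDictionary_one'` (saturation supplied by
`glue_saturated`, setups by `nonempty` hypothesis of that reduction). -/
theorem glue_stub (h₁ : rankOneCoprime) (h₂ : dictCoprimePinned) :
    takahashi2001_thm_2_3_of_coprime := by
  refine takahashi2001_thm_2_3_of_coprime_of_brandtDictionary_one' ?_
  intro W _ M r _ hr hcop hN P hmin hne
  obtain ⟨S⟩ := hne
  classical
  letI : Fintype (Brandt.ClassSet S.O) := Fintype.ofFinite _
  obtain ⟨pb, pf, hadj, hδ, hsurj, hmem⟩ := h₂ W M r hr hcop hN P hmin S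
  exact ⟨S, inferInstance, degreeZeroLattice _, pb, pf, hadj, hδ, hsurj,
    fun m v hm hv => glue_saturated m v hm hv, h₁ W M r hr hcop hN P S, hmem⟩

/-- **The whole of PLAN A+B in one line: the stub from (i) the tree's standing named fact
`HeckeTraceFormulaGL2Level` (all levels, weight 2, trivial character), (ii) the pinned dictionary
H2′, (iii) `helper_ellipticTerm` (the only `sorry` above).** -/
theorem stub_takahashi_of_plan (hTF : ∀ (N : ℕ) [NeZero N], HeckeTraceFormulaGL2Level N 1 2)
    (h₂ : dictCoprimePinned) : takahashi2001_thm_2_3_of_coprime :=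
  glue_stub (glue_H1 hTF) h₂



end Summit.ABC.ABC.Cruxes.DefiniteRTControlPrime.StubIdeas1

end
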